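import Summits.ResolutionOfSingularities.ResolutionOfSingularities.Theorems.EquisingularLiftEquisingularLiftNatDeltaConeLift
import Literature.AlgebraicGeometry.Resolution.Dehomogenization
import Mathlib
import HarnessLib

/-!
# [OURS · L1 W4.5(b)] T-CLUSTER-LIFT — a form vanishing to prescribed orders at a DOWNSTAIRS cluster lifts to a form over `O`
# vanishing to the same orders along ANY lifted cluster of `O`-points, provided the cluster imposes independent conditions
# (crux `EquisingularLiftNat` = stmt-ResolutionOfSingularities-20038, line `sections`; ring core of rung v7′ (TC⁺⁺))

NOT a statement of any manuscript. Helper file of the chain res-L1-w45b (cell `res-hironaka`, LADDER-RESOLUTION rung L,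
slot W4.5(b)); OURS; AI-written, weaker than expert review; filed `--supports stmt-ResolutionOfSingularities-20038 --as helper`
by res-L1-w45b-stub-3 (self-dealt object T-CLUSTER-LIFT, HOME STATUS 2026-08-27T10:16Z). No `sorry`; standard axioms.

WHERE IT SITS. res-L1-w45b-lead-2's RUNG LADDER (LEAD-MEMO-5 §A) for the isolated residue `stub_elnat_three_isolated_nontc`:
v5 TCΔ → v7 TC⁺ (in-carrier point steps at AT MOST ONE singular point of the carrier curve `Z = V(g) ⊂ e ≅ ℙ^{r-1}_k`; DESIGN
v6: «two singular points sectioned in the same carrier curve is EXACTLY where liftability becomes an incidence condition») →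
**v7′ TC⁺⁺**: SEVERAL singular points sectioned, under res-L1-w45b-tri-1's SUPERABUNDANCE-FREE condition (XDERIVE-M1 Y3(ii)):
«if the weighted cluster `Z` imposes INDEPENDENT conditions on `|𝒪_E(Γ)|` (`h¹(𝓘_Z ⊗ 𝒪_E(Γ)) = 0`) then for ANY lift of `Z` to
a cluster of `O`-sections there is a lift `D` of `Γ` with multiplicity `≥ m_P` at every lifted point: the Taylor conditions are
`O`-linear, `T_k` onto ⇒ `coker T_O` torsion-free ⇒ `(ker T_O) ⊗ k = ker T_k ∋ G` ⇒ `G` lifts inside `ker T_O`»; LEAD-MEMO-5: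
«needs an `h¹ = 0 ⇒` torsion-free-coker lift lemma + a downstairs spelling of `h¹(𝓘_cluster(d)) = 0` (rank of the Taylor
matrix = number of conditions)». This file is that lemma, for clusters of PROPER points (infinitely-near points are not treated),
in the chart currency of T-ΔLIFT (…NatDeltaConeLift, p516044):

* §1 MODULE LEMMA (Nakayama, Stacks 00DV): `I ≤ jacobson ⊥`, `T : M →ₗ[O] N`, `N` finitely generated, `range T ⊔ I•⊤ = ⊤` ⇒ `T`
  onto (`range_eq_top_of_range_sup_smul_top`) and `T x ≡ w (mod I•N)` ⇒ `x ≡ y (mod I•M)` for some `y` with `T y = w`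
  (`exists_eq_sub_mem_smul_top`; kernel form `exists_mem_ker_sub_mem_smul_top`) — «torsion-free cokernel ⇒ kernels reduce onto
  kernels»;
* §2 FUNCTIONAL FORM (`exists_isHomogeneous_lift_of_forall_apply_eq[_zero]`): `π : O ↠ k`, `ker π ≤ jacobson ⊥` (e.g. `O` local,
  `ker_le_jacobson_bot_of_isLocalRing`), finitely many `O`-linear functionals `Λ_j` on `O[T_σ]` with reductions `λ_j` on `k[T_σ]`;
  if `(λ_j)_j` is ONTO `k^J` on the degree-`d` forms then every degree-`d` form `g` with `λ_j g = π w_j` lifts to a degree-`d`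
  form `G`, `map π G = g`, `Λ_j G = w_j`;
* §3 TAYLOR DICTIONARY over any commutative ring (`mem_pow_span_X_sub_C_iff`): `f ∈ (X_i − a_i : i)^m` iff every coefficient of
  degree `< m` of `f(X + a)` (`aeval (X i + C (a i)) f`) vanishes (Mathlib `mem_pow_idealOfVars_iff'` moved along the translation);
  compatibility with `map π` (`map_aeval_X_add_C`, `map_mem_pow_span_X_sub_C`) and with `Literature…Resolution.dehomogenize`;
* §4 HEADLINE (`exists_isHomogeneous_lift_forall_dehomogenize_mem_pow`, `…_forall_coeff_eq` with prescribed upstairs jets,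
  `…_of_isLocalRing`): finitely many `O`-points `a_t` on charts `i_t` (affine coordinates `{j ≠ i_t} → O`), exponents `m_t`;
  `g ∈ k[T_σ]_d` with `g(T_{i_t} := 1) ∈ 𝔪_{ā_t}^{m_t}` ∀ `t`; INDEPENDENCE: the downstairs Taylor-jet map
  `k[T]_d → ⊕_t k[U]_{< m_t}` is onto ⇒ THERE IS `G ∈ O[T_σ]_d` homogeneous, `map π G = g`, `G(T_{i_t} := 1) ∈ 𝔪_{a_t}^{m_t}` ∀ `t`
  — an `O`-lift of order `≥ m_t` along EVERY section at once (order exactly `m_t` downstairs then makes it EQUIMULTIPLE along each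
  section: the hypothesis of T-M1-EXACT p515745 / T-M1-SCHEME p519966, `St = Bl` with exact special fibre).

SCOPE (res-L1-w45b-plan-1 10:16:29Z): this is the POSITIVE half of card 9 `cluster-strata-lift`'s criterion — the superabundance-free
lift. The INDEPENDENCE hypothesis is exactly what FAILS on F₇⁻ (42 conditions on a 36-dimensional system: `fano_configuration_no_lift`
p492869, T-F7MINUS p513480) and on res-L1-w45b-idea-2's certified ISLAND rows (R6-7); nothing is claimed there (negative half =
idea-2's island / E-negativity side).

References: The Stacks Project, Tag 00DV; Mathlib `Submodule.le_of_le_smul_of_le_jacobson_bot`, `MvPolynomial.mem_pow_idealOfVars_iff'`.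
Tree inputs: `…Sections.exists_isHomogeneous_map_eq_of_surjective` (res-type-032 p516044), `Literature…Resolution.dehomogenize`.
res-L1-w45b-lead-2 LEAD-MEMO-5 e186de0624463c55 §A; res-L1-w45b-tri-1 XDERIVE-M1-DELTAJUNCTION b5629e966fb70e6a Y3 (OURS, index only).
-/

set_option linter.dupNamespace false -- mandated namespace `Summit.<Summit>.<Problem>` of this single-conjunct summit

noncomputable section

open MvPolynomial Literature.AlgebraicGeometry.Resolution  -- (opened at top level: inside `…Theorems` a relative `MvPolynomial` namespace shadows the root one)
open Summit.ResolutionOfSingularities.ResolutionOfSingularities.Cruxes.EquisingularLiftNat.Sections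
  (exists_isHomogeneous_map_eq_of_surjective)

namespace Summit.ResolutionOfSingularities.ResolutionOfSingularities.Theorems.EquisingularLiftNat.ClusterLift

/-! ## §1 Nakayama: a map onto modulo `I` is onto, and then kernels reduce onto kernels -/

section Module

variable {O : Type*} [CommRing O] {M N : Type*} [AddCommGroup M] [Module O M] [AddCommGroup N] [Module O N]

/-- **Nakayama.** If `N` is finitely generated, `I ≤ jacobson ⊥` and `range T ⊔ I • ⊤ = ⊤` (i.e. `T` is onto modulo `I`),
then `T` is onto. [Stacks 00DV] [OURS · L1 W4.5b] -/
theorem range_eq_top_of_range_sup_smul_top [Module.Finite O N] {I : Ideal O}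
    (hI : I ≤ (⊥ : Ideal O).jacobson) (T : M →ₗ[O] N)
    (h : LinearMap.range T ⊔ I • (⊤ : Submodule O N) = ⊤) : LinearMap.range T = ⊤ :=
  top_le_iff.mp (Submodule.le_of_le_smul_of_le_jacobson_bot Module.Finite.fg_top hI h.symm.le)

/-- **Kernels reduce onto kernels (torsor form).** If `T` is onto and `T x ≡ w (mod I • N)`, then `x ≡ y (mod I • M)` for
some `y` with `T y = w`: `I • N = T (I • M)`. [folklore] [OURS · L1 W4.5b] -/
theorem exists_eq_sub_mem_smul_top_of_range_eq_top {I : Ideal O} (T : M →ₗ[O] N)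
    (hT : LinearMap.range T = ⊤) {x : M} {w : N} (hx : T x - w ∈ I • (⊤ : Submodule O N)) :
    ∃ y : M, T y = w ∧ x - y ∈ I • (⊤ : Submodule O M) := by
  have hI : I • (⊤ : Submodule O N) = Submodule.map T (I • ⊤) := by
    rw [Submodule.map_smul'', Submodule.map_top, hT]
  rw [hI] at hx
  obtain ⟨z, hz, hzx⟩ := hx
  refine ⟨x - z, ?_, by simpa using hz⟩
  rw [map_sub, hzx, sub_sub_cancel]

/-- **The lift lemma (torsor form).** `N` finitely generated, `I ≤ jacobson ⊥`, `T` onto modulo `I`, `T x ≡ w (mod I • N)` ⇒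
`∃ y, T y = w ∧ x ≡ y (mod I • M)`. [Stacks 00DV + folklore] [OURS · L1 W4.5b] -/
theorem exists_eq_sub_mem_smul_top [Module.Finite O N] {I : Ideal O} (hI : I ≤ (⊥ : Ideal O).jacobson)
    (T : M →ₗ[O] N) (h : LinearMap.range T ⊔ I • (⊤ : Submodule O N) = ⊤) {x : M} {w : N}
    (hx : T x - w ∈ I • (⊤ : Submodule O N)) : ∃ y : M, T y = w ∧ x - y ∈ I • (⊤ : Submodule O M) :=
  exists_eq_sub_mem_smul_top_of_range_eq_top T (range_eq_top_of_range_sup_smul_top hI T h) hx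

/-- **The lift lemma («`h¹ = 0 ⇒` torsion-free cokernel ⇒ `(ker T) ⊗ O/I ↠ ker (T ⊗ O/I)`»).** `N` finitely generated,
`I ≤ jacobson ⊥`, `T` onto modulo `I`, `T x ∈ I • N` ⇒ `∃ y ∈ ker T, x ≡ y (mod I • M)`. [OURS · L1 W4.5b] -/
theorem exists_mem_ker_sub_mem_smul_top [Module.Finite O N] {I : Ideal O} (hI : I ≤ (⊥ : Ideal O).jacobson)
    (T : M →ₗ[O] N) (h : LinearMap.range T ⊔ I • (⊤ : Submodule O N) = ⊤) {x : M}
    (hx : T x ∈ I • (⊤ : Submodule O N)) : ∃ y ∈ LinearMap.ker T, x - y ∈ I • (⊤ : Submodule O M) := by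
  obtain ⟨y, hy, hxy⟩ := exists_eq_sub_mem_smul_top hI T h (x := x) (w := 0) (by simpa using hx)
  exact ⟨y, LinearMap.mem_ker.mpr hy, hxy⟩

end Module

/-! ## §1b Bookkeeping: `I • ⊤` in `O^J` and in `O[T]` -/

section Bookkeeping

variable {O : Type*} [CommRing O]

/-- A vector with all coordinates in `I` lies in `I • O^J` (`J` finite). [folklore] -/
theorem mem_smul_top_pi_of_forall_mem {J : Type*} [Finite J] {I : Ideal O} {w : J → O} (hw : ∀ j, w j ∈ I) :
    w ∈ I • (⊤ : Submodule O (J → O)) := by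
  classical
  cases nonempty_fintype J
  rw [← Finset.univ_sum_single w]
  refine Submodule.sum_mem _ fun j _ => ?_
  have : (Pi.single j (w j) : J → O) = w j • (Pi.single j (1 : O) : J → O) := by
    ext j'
    by_cases h : j' = j
    · subst h; simp
    · simp [Pi.single_eq_of_ne h]
  rw [this]
  exact Submodule.smul_mem_smul (hw j) Submodule.mem_top

/-- Reduction kills `(ker π) • P` for every `O`-submodule `P` of `O[T_σ]`. [folklore] -/
theorem map_eq_zero_of_mem_ker_smul {k : Type*} [CommRing k] (π : O →+* k) {σ : Type*}
    {P : Submodule O (MvPolynomial σ O)} {x : MvPolynomial σ O} (hx : x ∈ RingHom.ker π • P) :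
    MvPolynomial.map π x = 0 := by
  refine Submodule.smul_induction_on hx (fun r hr p _ => ?_) (fun x y hx hy => ?_)
  · rw [MvPolynomial.smul_eq_C_mul, map_mul, map_C, RingHom.mem_ker.mp hr, C_0, zero_mul]
  · rw [map_add, hx, hy, add_zero]

/-- Over a local ring, the kernel of a map onto a non-trivial ring lies in the Jacobson radical. [folklore] -/
theorem ker_le_jacobson_bot_of_isLocalRing [IsLocalRing O] {k : Type*} [CommRing k] [Nontrivial k] (π : O →+* k) :
    RingHom.ker π ≤ (⊥ : Ideal O).jacobson := by
  rw [IsLocalRing.jacobson_eq_maximalIdeal ⊥ bot_ne_top]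
  exact IsLocalRing.le_maximalIdeal (RingHom.ker_ne_top π)

end Bookkeeping

/-! ## §2 Functional form: forms annihilated by independent reduced functionals lift inside the kernel -/

section Functional

variable {O k : Type*} [CommRing O] [CommRing k] (π : O →+* k) {σ : Type*} {J : Type*} [Finite J]

/-- **T-CLUSTER-LIFT, functional form (with prescribed values).** `π : O ↠ k` with `ker π ≤ jacobson ⊥`; `Λ_j`
(`j ∈ J`, finite) `O`-linear functionals on `O[T_σ]` with reductions `λ_j` (`π (Λ_j F) = λ_j (map π F)`); INDEPENDENCE: on the
degree-`d` forms `(λ_j)_j` takes every value `v ∈ k^J`. Then every degree-`d` form `g` over `k` with `λ_j g = π w_j` has a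
degree-`d` lift `G` over `O` with `map π G = g` and `Λ_j G = w_j` for all `j`. [OURS · L1 W4.5b] -/
theorem exists_isHomogeneous_lift_of_forall_apply_eq (hπ : Function.Surjective π)
    (hker : RingHom.ker π ≤ (⊥ : Ideal O).jacobson) {d : ℕ}
    (Λ : J → (MvPolynomial σ O →ₗ[O] O)) (lam : J → (MvPolynomial σ k →ₗ[k] k))
    (hΛ : ∀ j F, π (Λ j F) = lam j (MvPolynomial.map π F))
    (hind : ∀ v : J → k, ∃ g : MvPolynomial σ k, g.IsHomogeneous d ∧ ∀ j, lam j g = v j)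
    (g : MvPolynomial σ k) (hg : g.IsHomogeneous d) (w : J → O) (hgw : ∀ j, lam j g = π (w j)) :
    ∃ G : MvPolynomial σ O, G.IsHomogeneous d ∧ MvPolynomial.map π G = g ∧ ∀ j, Λ j G = w j := by
  classical
  let Md : Submodule O (MvPolynomial σ O) := homogeneousSubmodule σ O d
  let T : Md →ₗ[O] (J → O) := (LinearMap.pi fun j => Λ j) ∘ₗ Md.subtype
  have hTapply : ∀ (x : Md) (j : J), T x j = Λ j (x : MvPolynomial σ O) := fun x j => rfl
  have hmk : ∀ (G₁ : MvPolynomial σ O) (hG₁ : G₁.IsHomogeneous d) (g₁ : MvPolynomial σ k) (u : J → O),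
      MvPolynomial.map π G₁ = g₁ → (∀ j, lam j g₁ = π (u j)) →
      T ⟨G₁, (mem_homogeneousSubmodule d G₁).mpr hG₁⟩ - u ∈ RingHom.ker π • (⊤ : Submodule O (J → O)) := by
    intro G₁ hG₁ g₁ u hG₁g hu
    refine mem_smul_top_pi_of_forall_mem fun j => ?_
    rw [RingHom.mem_ker, Pi.sub_apply, map_sub, hTapply, hΛ, hG₁g, hu, sub_self]
  -- Step 1: `T` is onto modulo `ker π` (independence downstairs + forms lift to forms)
  have hsup : LinearMap.range T ⊔ RingHom.ker π • (⊤ : Submodule O (J → O)) = ⊤ := by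
    rw [eq_top_iff]
    rintro v -
    obtain ⟨g₁, hg₁, hg₁v⟩ := hind fun j => π (v j)
    obtain ⟨G₁, hG₁, hG₁g⟩ := exists_isHomogeneous_map_eq_of_surjective π hπ g₁ hg₁
    have hmem := hmk G₁ hG₁ g₁ v hG₁g hg₁v
    have hv : v = T ⟨G₁, (mem_homogeneousSubmodule d G₁).mpr hG₁⟩ -
        (T ⟨G₁, (mem_homogeneousSubmodule d G₁).mpr hG₁⟩ - v) := (sub_sub_cancel _ _).symm
    rw [hv]
    exact Submodule.sub_mem_sup (LinearMap.mem_range_self T _) hmem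
  -- Step 2: lift `g`, then correct inside `(ker π) • O[T]_d`
  obtain ⟨G₀, hG₀, hG₀g⟩ := exists_isHomogeneous_map_eq_of_surjective π hπ g hg
  obtain ⟨y, hTy, hxy⟩ := exists_eq_sub_mem_smul_top hker T hsup (hmk G₀ hG₀ g w hG₀g hgw)
  refine ⟨(y : MvPolynomial σ O), (mem_homogeneousSubmodule d _).mp y.2, ?_, fun j => by rw [← hTapply, hTy]⟩
  have h0 : MvPolynomial.map π (((⟨G₀, (mem_homogeneousSubmodule d G₀).mpr hG₀⟩ : Md) - y : Md) :
      MvPolynomial σ O) = 0 :=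
    map_eq_zero_of_mem_ker_smul π ((Submodule.mem_smul_top_iff _ _ _).mp hxy)
  rw [Submodule.coe_sub, map_sub, sub_eq_zero] at h0
  rw [← h0, hG₀g]

/-- **T-CLUSTER-LIFT, functional form (kernel).** As `exists_isHomogeneous_lift_of_forall_apply_eq` with `w = 0`: every
degree-`d` form annihilated by the reduced functionals lifts to a degree-`d` form annihilated by the functionals — «the Taylor
conditions are `O`-linear, `T_k` onto ⇒ `(ker T_O) ⊗ k = ker T_k`» (res-L1-w45b-tri-1 Y3(ii)). [OURS · L1 W4.5b] -/
theorem exists_isHomogeneous_lift_of_forall_apply_eq_zero (hπ : Function.Surjective π)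
    (hker : RingHom.ker π ≤ (⊥ : Ideal O).jacobson) {d : ℕ}
    (Λ : J → (MvPolynomial σ O →ₗ[O] O)) (lam : J → (MvPolynomial σ k →ₗ[k] k))
    (hΛ : ∀ j F, π (Λ j F) = lam j (MvPolynomial.map π F))
    (hind : ∀ v : J → k, ∃ g : MvPolynomial σ k, g.IsHomogeneous d ∧ ∀ j, lam j g = v j)
    (g : MvPolynomial σ k) (hg : g.IsHomogeneous d) (hg0 : ∀ j, lam j g = 0) :
    ∃ G : MvPolynomial σ O, G.IsHomogeneous d ∧ MvPolynomial.map π G = g ∧ ∀ j, Λ j G = 0 := by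
  exact exists_isHomogeneous_lift_of_forall_apply_eq π hπ hker Λ lam hΛ hind g hg 0
    (fun j => by rw [hg0, Pi.zero_apply, map_zero])

end Functional

/-! ## §3 Taylor dictionary: `f ∈ 𝔪_a^m` iff the jets of order `< m` of `f(X + a)` vanish -/

section Taylor

variable {R : Type*} [CommRing R] {τ : Type*}

/-- `f(X + a)(X − a) = f`: un-shifting after shifting is the identity (checked on variables). [folklore] -/
theorem aeval_X_sub_C_aeval_X_add_C (a : τ → R) (f : MvPolynomial τ R) :
    aeval (fun i : τ => (X i : MvPolynomial τ R) - C (a i)) (aeval (fun i : τ => (X i : MvPolynomial τ R) + C (a i)) f)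
      = f := by
  rw [← AlgHom.comp_apply]
  conv_rhs => rw [← AlgHom.id_apply (R := R) f]
  congr 1
  refine MvPolynomial.algHom_ext fun i => ?_
  simp

/-- `f(X − a)(X + a) = f`. [folklore] -/
theorem aeval_X_add_C_aeval_X_sub_C (a : τ → R) (f : MvPolynomial τ R) :
    aeval (fun i : τ => (X i : MvPolynomial τ R) + C (a i)) (aeval (fun i : τ => (X i : MvPolynomial τ R) - C (a i)) f)
      = f := by
  rw [← AlgHom.comp_apply]
  conv_rhs => rw [← AlgHom.id_apply (R := R) f]
  congr 1
  refine MvPolynomial.algHom_ext fun i => ?_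
  simp

/-- The shift `X ↦ X + a` carries the ideal `(X_i − a_i : i)` of the point `a` to the ideal `(X_i : i)` of the origin.
[folklore] -/
theorem map_aeval_span_X_sub_C (a : τ → R) :
    Ideal.map (aeval fun i : τ => (X i : MvPolynomial τ R) + C (a i))
      (Ideal.span (Set.range fun i : τ => (X i : MvPolynomial τ R) - C (a i))) = idealOfVars τ R := by
  rw [Ideal.map_span, ← Set.range_comp]
  congr 2; funext i; simp

/-- The shift `X ↦ X − a` carries the ideal `(X_i : i)` of the origin to the ideal `(X_i − a_i : i)` of `a`. [folklore] -/
theorem map_aeval_idealOfVars (a : τ → R) :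
    Ideal.map (aeval fun i : τ => (X i : MvPolynomial τ R) - C (a i)) (idealOfVars τ R)
      = Ideal.span (Set.range fun i : τ => (X i : MvPolynomial τ R) - C (a i)) := by
  rw [idealOfVars, Ideal.map_span, ← Set.range_comp]
  congr 2; funext i; simp

/-- **Taylor dictionary.** Over any commutative ring: `f ∈ (X_i − a_i : i)^m` iff every coefficient of degree `< m` of the
shifted polynomial `f(X + a)` vanishes («`f` has order `≥ m` at the point `a`» ⟺ «the jet of order `< m` of `f` at `a` is zero»;
in characteristic `p` these coefficients are the HASSE derivatives at `a`, not the ordinary ones). [folklore] [OURS · L1 W4.5b] -/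
theorem mem_pow_span_X_sub_C_iff (a : τ → R) (m : ℕ) (f : MvPolynomial τ R) :
    f ∈ (Ideal.span (Set.range fun i : τ => (X i : MvPolynomial τ R) - C (a i))) ^ m ↔
      ∀ α : τ →₀ ℕ, α.degree < m → coeff α (aeval (fun i : τ => (X i : MvPolynomial τ R) + C (a i)) f) = 0 := by
  rw [← mem_pow_idealOfVars_iff']
  constructor
  · intro h
    have := Ideal.mem_map_of_mem (aeval fun i : τ => (X i : MvPolynomial τ R) + C (a i)) h
    rwa [Ideal.map_pow, map_aeval_span_X_sub_C] at this
  · intro h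
    have := Ideal.mem_map_of_mem (aeval fun i : τ => (X i : MvPolynomial τ R) - C (a i)) h
    rwa [Ideal.map_pow, map_aeval_idealOfVars, aeval_X_sub_C_aeval_X_add_C] at this

/-- The shift commutes with change of coefficients: `map f (F(X + a)) = (map f F)(X + f a)`. [folklore] -/
theorem map_aeval_X_add_C {S : Type*} [CommRing S] (f : R →+* S) (a : τ → R) (F : MvPolynomial τ R) :
    MvPolynomial.map f (aeval (fun i : τ => (X i : MvPolynomial τ R) + C (a i)) F)
      = aeval (fun i : τ => (X i : MvPolynomial τ S) + C (f (a i))) (MvPolynomial.map f F) := by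
  rw [MvPolynomial.aeval_eq_bind₁, MvPolynomial.aeval_eq_bind₁, map_bind₁]
  simp only [map_add, map_X, map_C]

/-- Order `≥ m` at a point is preserved by change of coefficients: `F ∈ 𝔪_a^m ⇒ map f F ∈ 𝔪_{f a}^m`. [folklore] -/
theorem map_mem_pow_span_X_sub_C {S : Type*} [CommRing S] (f : R →+* S) (a : τ → R) (m : ℕ) {F : MvPolynomial τ R}
    (hF : F ∈ (Ideal.span (Set.range fun i : τ => (X i : MvPolynomial τ R) - C (a i))) ^ m) :
    MvPolynomial.map f F ∈ (Ideal.span (Set.range fun i : τ => (X i : MvPolynomial τ S) - C (f (a i)))) ^ m := by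
  rw [mem_pow_span_X_sub_C_iff] at hF ⊢
  intro α hα
  rw [← map_aeval_X_add_C, coeff_map, hF α hα, map_zero]

end Taylor

/-! ## §4 Headline: lifting a form through a cluster of sections -/

section Cluster

variable {O k : Type*} [CommRing O] [CommRing k] (π : O →+* k)
variable {σ : Type*} [Finite σ] [DecidableEq σ] {ι : Type*} [Finite ι]

/-- Exponents of bounded degree in finitely many variables form a finite type. [folklore] -/
theorem finite_subtype_degree_lt {τ : Type*} [Finite τ] (m : ℕ) : Finite {α : τ →₀ ℕ // α.degree < m} := by
  classical
  refine Finite.of_injective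
    (fun α : {α : τ →₀ ℕ // α.degree < m} => fun j : τ =>
      (⟨α.1 j, lt_of_le_of_lt (Finsupp.le_degree j α.1) α.2⟩ : Fin m)) ?_
  intro α β h
  apply Subtype.ext
  ext j
  simpa using congrArg Fin.val (congr_fun h j)

/-- **T-CLUSTER-LIFT (headline, prescribed jets).** `π : O ↠ k`, `ker π ≤ jacobson ⊥` (e.g. `O` local). Data: finitely many
`O`-points `a_t` on charts `i_t` of `ℙ(O[T_σ])` (affine coordinates `a_t : {j // j ≠ i_t} → O`), exponents `m_t`, a degree-`d`
form `g` over `k`, and prescribed upstairs jets `W t α ∈ O` (`|α| < m_t`) reducing to the jets of `g` at the reduced cluster: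
`π (W t α) = coeff_α (g(T_{i_t} := 1)(U + ā_t))`. INDEPENDENCE: the downstairs Taylor-jet map on `k[T_σ]_d` at the reduced
cluster takes every value. THEN there is a degree-`d` form `G` over `O` with `map π G = g` and upstairs jets
`coeff_α (G(T_{i_t} := 1)(U + a_t)) = W t α` for all `t` and `|α| < m_t`. [OURS · L1 W4.5b] -/
theorem exists_isHomogeneous_lift_forall_coeff_eq (hπ : Function.Surjective π)
    (hker : RingHom.ker π ≤ (⊥ : Ideal O).jacobson) {d : ℕ} (i : ι → σ)
    (a : (t : ι) → {j : σ // j ≠ i t} → O) (m : ι → ℕ)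
    (hind : ∀ v : (t : ι) → ({j : σ // j ≠ i t} →₀ ℕ) → k, ∃ g : MvPolynomial σ k, g.IsHomogeneous d ∧
      ∀ t α, α.degree < m t →
        coeff α (aeval (fun j => (X j : MvPolynomial {j : σ // j ≠ i t} k) + C (π (a t j))) (dehomogenize (i t) g))
          = v t α)
    (g : MvPolynomial σ k) (hg : g.IsHomogeneous d) (W : (t : ι) → ({j : σ // j ≠ i t} →₀ ℕ) → O)
    (hgW : ∀ t α, α.degree < m t →
      coeff α (aeval (fun j => (X j : MvPolynomial {j : σ // j ≠ i t} k) + C (π (a t j))) (dehomogenize (i t) g))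
        = π (W t α)) :
    ∃ G : MvPolynomial σ O, G.IsHomogeneous d ∧ MvPolynomial.map π G = g ∧
      ∀ t α, α.degree < m t →
        coeff α (aeval (fun j => (X j : MvPolynomial {j : σ // j ≠ i t} O) + C (a t j)) (dehomogenize (i t) G))
          = W t α := by
  classical
  haveI : ∀ t, Finite {α : {j : σ // j ≠ i t} →₀ ℕ // α.degree < m t} := fun t => finite_subtype_degree_lt (m t)
  let J := Σ t : ι, {α : {j : σ // j ≠ i t} →₀ ℕ // α.degree < m t}
  let Λ : J → (MvPolynomial σ O →ₗ[O] O) := fun j =>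
    (lcoeff O (j.2 : {l : σ // l ≠ i j.1} →₀ ℕ)) ∘ₗ
      (aeval (fun l => (X l : MvPolynomial {l : σ // l ≠ i j.1} O) + C (a j.1 l))).toLinearMap ∘ₗ
        (dehomogenize (i j.1)).toLinearMap
  let lam : J → (MvPolynomial σ k →ₗ[k] k) := fun j =>
    (lcoeff k (j.2 : {l : σ // l ≠ i j.1} →₀ ℕ)) ∘ₗ
      (aeval (fun l => (X l : MvPolynomial {l : σ // l ≠ i j.1} k) + C (π (a j.1 l)))).toLinearMap ∘ₗ
        (dehomogenize (i j.1)).toLinearMap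
  have hΛapply : ∀ (j : J) (F : MvPolynomial σ O), Λ j F =
      coeff (j.2 : {l : σ // l ≠ i j.1} →₀ ℕ)
        (aeval (fun l => (X l : MvPolynomial {l : σ // l ≠ i j.1} O) + C (a j.1 l)) (dehomogenize (i j.1) F)) :=
    fun j F => rfl
  have hlamapply : ∀ (j : J) (F : MvPolynomial σ k), lam j F =
      coeff (j.2 : {l : σ // l ≠ i j.1} →₀ ℕ)
        (aeval (fun l => (X l : MvPolynomial {l : σ // l ≠ i j.1} k) + C (π (a j.1 l))) (dehomogenize (i j.1) F)) :=
    fun j F => rfl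
  have hΛ : ∀ j F, π (Λ j F) = lam j (MvPolynomial.map π F) := by
    intro j F
    rw [hΛapply, hlamapply, ← coeff_map, map_aeval_X_add_C, map_dehomogenize]
  have hind' : ∀ v : J → k, ∃ g : MvPolynomial σ k, g.IsHomogeneous d ∧ ∀ j, lam j g = v j := by
    intro v
    obtain ⟨g₁, hg₁, h⟩ := hind fun t α => if hα : α.degree < m t then v ⟨t, α, hα⟩ else 0
    refine ⟨g₁, hg₁, fun j => ?_⟩
    rw [hlamapply, h j.1 j.2 j.2.2, dif_pos j.2.2]
  obtain ⟨G, hG, hGg, hΛG⟩ := exists_isHomogeneous_lift_of_forall_apply_eq π hπ hker Λ lam hΛ hind' g hg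
    (fun j => W j.1 j.2) (fun j => by rw [hlamapply, hgW j.1 j.2 j.2.2])
  refine ⟨G, hG, hGg, fun t α hα => ?_⟩
  rw [← hΛapply ⟨t, α, hα⟩, hΛG]

/-- **T-CLUSTER-LIFT (headline).** `π : O ↠ k` with `ker π ≤ jacobson ⊥` (e.g. `O` local). Given finitely many `O`-points
`a_t` on charts `i_t` (affine coordinates `a_t : {j // j ≠ i_t} → O`), exponents `m_t`, and a degree-`d` form `g ∈ k[T_σ]`
with `g(T_{i_t} := 1) ∈ 𝔪_{ā_t}^{m_t}` for every `t` (order `≥ m_t` at every point of the REDUCED cluster), suppose the reduced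
cluster imposes INDEPENDENT CONDITIONS on degree-`d` forms: the Taylor-jet map `g' ↦ (coeff_α (g'(T_{i_t} := 1)(U + ā_t)))_{t, |α| < m_t}`
takes every prescribed value `v` (superabundance-free, `h¹(𝓘_Z(d)) = 0`). THEN `g` lifts to a degree-`d` form `G ∈ O[T_σ]` with
`map π G = g` and `G(T_{i_t} := 1) ∈ 𝔪_{a_t}^{m_t}` for every `t`: an `O`-lift of order `≥ m_t` along EVERY section of the
lifted cluster at once. (res-L1-w45b-tri-1 XDERIVE-M1 Y3(ii); rung v7′ TC⁺⁺ of res-L1-w45b-lead-2 LEAD-MEMO-5.) [OURS · L1 W4.5b] -/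
theorem exists_isHomogeneous_lift_forall_dehomogenize_mem_pow (hπ : Function.Surjective π)
    (hker : RingHom.ker π ≤ (⊥ : Ideal O).jacobson) {d : ℕ} (i : ι → σ)
    (a : (t : ι) → {j : σ // j ≠ i t} → O) (m : ι → ℕ)
    (hind : ∀ v : (t : ι) → ({j : σ // j ≠ i t} →₀ ℕ) → k, ∃ g : MvPolynomial σ k, g.IsHomogeneous d ∧
      ∀ t α, α.degree < m t →
        coeff α (aeval (fun j => (X j : MvPolynomial {j : σ // j ≠ i t} k) + C (π (a t j))) (dehomogenize (i t) g))
          = v t α)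
    (g : MvPolynomial σ k) (hg : g.IsHomogeneous d)
    (hgZ : ∀ t, dehomogenize (i t) g ∈
      (Ideal.span (Set.range fun j => (X j : MvPolynomial {j : σ // j ≠ i t} k) - C (π (a t j)))) ^ (m t)) :
    ∃ G : MvPolynomial σ O, G.IsHomogeneous d ∧ MvPolynomial.map π G = g ∧
      ∀ t, dehomogenize (i t) G ∈
        (Ideal.span (Set.range fun j => (X j : MvPolynomial {j : σ // j ≠ i t} O) - C (a t j))) ^ (m t) := by
  obtain ⟨G, hG, hGg, hW⟩ := exists_isHomogeneous_lift_forall_coeff_eq π hπ hker i a m hind g hg (fun _ _ => 0)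
    (fun t α hα => by rw [map_zero]; exact (mem_pow_span_X_sub_C_iff _ _ _).mp (hgZ t) α hα)
  exact ⟨G, hG, hGg, fun t => (mem_pow_span_X_sub_C_iff _ _ _).mpr fun α hα => hW t α hα⟩

/-- **T-CLUSTER-LIFT over a local ring** (the chain's `O` is a DVR with residue map `π : O ↠ k`): the headline with the Jacobson
hypothesis discharged by `ker_le_jacobson_bot_of_isLocalRing`. [OURS · L1 W4.5b] -/
theorem exists_isHomogeneous_lift_forall_dehomogenize_mem_pow_of_isLocalRing [IsLocalRing O] [Nontrivial k]
    (hπ : Function.Surjective π) {d : ℕ} (i : ι → σ)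
    (a : (t : ι) → {j : σ // j ≠ i t} → O) (m : ι → ℕ)
    (hind : ∀ v : (t : ι) → ({j : σ // j ≠ i t} →₀ ℕ) → k, ∃ g : MvPolynomial σ k, g.IsHomogeneous d ∧
      ∀ t α, α.degree < m t →
        coeff α (aeval (fun j => (X j : MvPolynomial {j : σ // j ≠ i t} k) + C (π (a t j))) (dehomogenize (i t) g))
          = v t α)
    (g : MvPolynomial σ k) (hg : g.IsHomogeneous d)
    (hgZ : ∀ t, dehomogenize (i t) g ∈
      (Ideal.span (Set.range fun j => (X j : MvPolynomial {j : σ // j ≠ i t} k) - C (π (a t j)))) ^ (m t)) :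
    ∃ G : MvPolynomial σ O, G.IsHomogeneous d ∧ MvPolynomial.map π G = g ∧
      ∀ t, dehomogenize (i t) G ∈
        (Ideal.span (Set.range fun j => (X j : MvPolynomial {j : σ // j ≠ i t} O) - C (a t j))) ^ (m t) :=
  exists_isHomogeneous_lift_forall_dehomogenize_mem_pow π hπ (ker_le_jacobson_bot_of_isLocalRing π) i a m hind g hg hgZ

end Cluster

end Summit.ResolutionOfSingularities.ResolutionOfSingularities.Theorems.EquisingularLiftNat.ClusterLift

end
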